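import Literature.MathematicalPhysics.QuantumFieldTheory.Balaban1983to89.B8IdxB8SubDRigidity
import Literature.MathematicalPhysics.QuantumFieldTheory.Balaban1983to89.T4TermwiseTorus
import Literature.MathematicalPhysics.QuantumFieldTheory.Balaban1983to89.B7AvgPeriodicity

/-!
# `Balaban1983to89.B8IdxB8SubDPeriodicTowers` — [Balaban1985RegularSpaces] (1.3)–(1.6) p. 77 («we admit the case where some domains Ω_j are equal to T_η»):
# PERIODICITY CLOSURE OF THE (1.5) TOWERS — at every member of the (1.5)-obeying index of record `Node00.IdxB8SubD θ`, periodicity of the DOMAINS `Ω_l`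
# ALONE (fine-lattice period `T = Lˡ·Q`) makes every constraint family `Λs m l` and every constraint-bond class `Λb m l` (`l ≤ m ≤ k`) `Q`-periodic in the
# level-`l` labels

statement-level skeleton of published theorems with citation tags; proofs where landed; nothing here is a claim about the Yang–Mills mass gap

T. Bałaban, *Spaces of regular gauge field configurations on a lattice and gauge fixing conditions*, Commun. Math. Phys. **99** (1985) 75–102 `[Balaban1985RegularSpaces]`
— (1.3)–(1.6) p. 77 («Λ_j = Ω_j^{(j)} ∖ Ω_{j+1}^{(j)}, j = 0, 1, …, k − 1, Λ_k = Ω_k^{(k)}», «we admit the case where some domains Ω_j are equal to T_η, for example Ω_j = T_η for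
j = 0,1,…,l, l ≤ k»), (1.31) p. 82, p. 86 («𝔅_k»), (1.68) p. 88.  The torus `T_η` is read, as everywhere in this tree (`B8Thm2TorusAt`, `B7AvgPeriodicity`, `T4TermwiseTorus`), as
`T`-PERIODIC DATA ON THE `ℤᵈ` CARRIER.

WHY (cell pub-ymgap, N05 [B8]; director-ym №217 «(β′-PERIODIC) is the road of record behind the [B8] display»; plan g86 PENS-217: P1 = the periodic member model `B8LeafModelZdPer`
(dag-n05-c), P2 = the periodic index ∕ pin ∕ door `Node00/CarriersB8Per` (dag-n05-w1), whose law `PerLaw P j` was worded «`P`-periodic `Ω_j, Λ_j`»; this file = width seat dag-n05-w2 g6,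
a reviewer seat of P2 for the (1.5) ∕ `LamTop` ∕ pin laws).  By RIGIDITY (`B8IdxB8SubDRigidity`, this seat g4: `IdxB8SubD.Λs_eq_lam`, `IdxB8SubD.Λb_eq_towerBonds_lam`) a (1.5)-member's
constraint towers carry NO datum beyond `(k, Ω)`: `Λs m l = B11Eq7Convention.Lam θ.L Ω m l` and `Λb m l = towerBonds θ.L Ω (B11Eq7Convention.Lam θ.L Ω m) l`.  Both are images of the
domains under maps commuting with lattice shifts (`loK`, `bondHiK`, the one-level block `[L•z, L•z + blockTop L]`), so periodicity of the domains is INHERITED by the towers — the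
«`Λ_j` periodic» clause of the law is a THEOREM on `IdxB8SubD`, not an extra field, and the periodic member model's translation-covariance arguments may read «`Λs ∕ Λb` periodic»
from the Ω-law by name.

PERIODICITY PREDICATE.  The tree's `T4TermwiseTorus.IsPeriodic T F := ∀ x m, F (x + (T:ℤ)•m) = F x` (dag-n05-c's choice for the fields of P1), applied to a SET `S` as
`IsPeriodic T (· ∈ S)`; `isPeriodic_mem_iff` ∕ `isPeriodic_mem_of_iff` ∕ `isPeriodic_mem_of_coord` are the `Iff` and coordinate-direction readings.  Nothing is re-declared.

WHAT IS PROVED (0 `def`, 0 sorry; std axioms):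
* §1 (generic, any `Ω`, any `L`): shift bookkeeping `loK_add_zsmul`, `bondHiK_add_zsmul`, `smul_add_zsmul`, `forall_inBox_add_iff`, `forall_block_add_iff` (+ private `inBox_add_iff`);
  ★ `isPeriodic_layer` (`Ω_l`, and `Ω_{l+1}` if `l < k`, `T`-periodic ⇒ `B8Ineq132.layer Ω k l` `T`-periodic); ★★ `lamK_add_zsmul_iff` ∕ `isPeriodic_lamK` (`T = Lˡ·Q` ⇒
  `B11Eq7Convention.Lam L Ω k l` is `Q`-periodic); ★★ `towerBonds_add_zsmul_iff` ∕ `isPeriodic_towerBonds` (`Ω_l` `T`-periodic, `Λ l` `Q`-periodic, `Λ (l−1)` `L·Q`-periodic,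
  `T = Lˡ·Q` ⇒ every `κ`-section of `towerBonds L Ω Λ l` is `Q`-periodic); `isPeriodic_towerBonds_lam` (the case `Λ := B11Eq7Convention.Lam L Ω m`, from the Ω-periods alone).
* §2 (the index of record): ★★ `IdxB8SubD.isPeriodic_Λs`, ★★ `IdxB8SubD.isPeriodic_Λb` (domains `T`-periodic up to level `k`, `T = θ.Lˡ·Q`, `l ≤ m ≤ k` ⇒ `Λs m l`, `Λb m l`
  `Q`-periodic), their `Iff` readings `IdxB8SubD.mem_Λs_add_zsmul_iff` ∕ `.mem_Λb_add_zsmul_iff`, the `m = k` readings `…_top`, and the divisibility forms `…_of_dvd` (`θ.Lᵏ ∣ T`,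
  period `T ∕ θ.Lˡ`).
* §3 (inhabitation support for the periodic cut): `isPeriodic_mem_univ` (+ private `domainSeq_univ`), ★ `exists_idxB8SubD_univTower` (print's «Ω_j = T_η for all j» tower is a member of
  `IdxB8SubD θ` at every depth — the member class of `B8Thm2TorusAt`), ★ `exists_idxB8SubD_isPeriodic` (that member is `T`-periodic for EVERY `T`, domains and towers).

HONEST FRAMING: lattice bookkeeping + two faces of `B8IdxB8SubDRigidity` BY NAME; NO estimate; nothing of Bałaban's asserted or refuted; no periodic law ∕ index ∕ pin ∕ door ∕ member
model is typed here (those are P1 ∕ P2's pens); count-neutral; N05 NOT discharged; one finite 𝕋⁴ programme at fixed ε, Bałaban AS PRINTED — NOT continuum ∕ ℝ⁴ ∕ OS ∕ mass gap ∕ Clay.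
No `sorry`, no `instance`, no `notation`. -/

noncomputable section

namespace Literature.MathematicalPhysics.QuantumFieldTheory.Balaban1983to89.B8IdxB8SubDPeriodicTowers

open B7Prop1Explicit B7Prop1Local
open B8Ineq132 (layer)
open B8Thm2LogB (blockTop)
open B8LeafModelZd (ZdIdx)
open B8ConstraintBonds (DomainSeq)
open B8IdxB8LawsB (towerBonds mem_towerBonds_iff)
open T4TermwiseTorus (IsPeriodic)
open B8IdxB8SubDRigidity (exists_idxB8SubD_of_domainSeq)
open Node00 (Stage3Params IdxB8SubD)

variable {d : ℕ}

/-! ## §1 Shift bookkeeping and the periodicity of print's level sets (generic `Ω`, `L`) -/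

section Generic

/-- The `Iff` reading of set periodicity `IsPeriodic T (· ∈ S)`. [cite: Balaban1985RegularSpaces, p.77 («Ω_j = T_η»)] -/
theorem isPeriodic_mem_iff {T : ℕ} {S : Set (B7Prop1Explicit.Site d)} (hS : IsPeriodic T (· ∈ S)) (x m : B7Prop1Explicit.Site d) :
    x + (T : ℤ) • m ∈ S ↔ x ∈ S :=
  Iff.of_eq (hS x m)

/-- Set periodicity from its `Iff` reading. [cite: Balaban1985RegularSpaces, p.77 («Ω_j = T_η»)] -/
theorem isPeriodic_mem_of_iff {T : ℕ} {S : Set (B7Prop1Explicit.Site d)} (h : ∀ x m : B7Prop1Explicit.Site d, x + (T : ℤ) • m ∈ S ↔ x ∈ S) :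
    IsPeriodic T (· ∈ S) :=
  fun x m => propext (h x m)

/-- The backward reading: `x − T•m ∈ S ↔ x ∈ S`. [cite: Balaban1985RegularSpaces, p.77 («Ω_j = T_η»)] -/
theorem isPeriodic_mem_sub_iff {T : ℕ} {S : Set (B7Prop1Explicit.Site d)} (hS : IsPeriodic T (· ∈ S)) (x m : B7Prop1Explicit.Site d) :
    x - (T : ℤ) • m ∈ S ↔ x ∈ S := by
  have h := isPeriodic_mem_iff hS (x - (T : ℤ) • m) m
  rw [sub_add_cancel] at h
  exact h.symm

/-- Set periodicity from the `d` coordinate periods `T•e_i` (the torus `T_η` as `ℤᵈ` modulo `Tℤᵈ`; `B7AvgPeriodicity.periodic_of_coord`).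
[cite: Balaban1985RegularSpaces, p.77 («Ω_j = T_η»)] -/
theorem isPeriodic_mem_of_coord {T : ℕ} {S : Set (B7Prop1Explicit.Site d)} (h : ∀ (x : B7Prop1Explicit.Site d) (i : Fin d), x + (T : ℤ) • e i ∈ S ↔ x ∈ S) :
    IsPeriodic T (· ∈ S) := by
  have hc : ∀ i : Fin d, B12Ineq417Flat.shiftCfg ((T : ℤ) • e i) (fun x => x ∈ S) = fun x => x ∈ S :=
    fun i => funext fun x => propext (h x i)
  intro x m
  exact congrFun (B7AvgPeriodicity.periodic_of_coord hc m) x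

/-- A coarser period: `T`-periodic ⇒ `n·T`-periodic. [cite: Balaban1985RegularSpaces, p.77 («Ω_j = T_η»)] -/
theorem isPeriodic_mem_mul {T : ℕ} {S : Set (B7Prop1Explicit.Site d)} (hS : IsPeriodic T (· ∈ S)) (n : ℕ) : IsPeriodic (n * T) (· ∈ S) := by
  refine isPeriodic_mem_of_iff fun x m => ?_
  have h := isPeriodic_mem_iff hS x ((n : ℤ) • m)
  rwa [smul_smul, ← Nat.cast_mul, mul_comm] at h

/-- `loK` commutes with label shifts: `Lˡ•(y + Q•m) = Lˡ•y + (LˡQ)•m`. [cite: Balaban1985Averaging, p.24 (B^k(c))] -/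
theorem loK_add_zsmul (L l : ℕ) (Q : ℤ) (y m : B7Prop1Explicit.Site d) :
    loK L l (y + Q • m) = loK L l y + (((L : ℤ) ^ l) * Q) • m := by
  funext i
  simp only [loK, Pi.add_apply, Pi.smul_apply, smul_eq_mul]
  ring

/-- `bondHiK` commutes with label shifts. [cite: Balaban1985Averaging, p.24 (B^k(c₋) ∪ B^k(c₊))] -/
theorem bondHiK_add_zsmul (L l : ℕ) (Q : ℤ) (y m : B7Prop1Explicit.Site d) (κ : Fin d) :
    bondHiK L l (y + Q • m) κ = bondHiK L l y κ + (((L : ℤ) ^ l) * Q) • m := by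
  funext i
  simp only [bondHiK, Pi.add_apply, Pi.smul_apply, smul_eq_mul]
  ring

/-- The one-level block corner commutes with label shifts: `L•(z + Q•m) = L•z + (L·Q)•m`. [cite: Balaban1985RegularSpaces, (1.37) p.82 (Γ_{b₋,x})] -/
theorem smul_add_zsmul (L : ℕ) (Q : ℤ) (z m : B7Prop1Explicit.Site d) :
    (L : ℤ) • (z + Q • m) = (L : ℤ) • z + ((L : ℤ) * Q) • m := by
  rw [smul_add, smul_smul]

/-- Boxes translate (private plumbing). [folklore] -/
private theorem inBox_add_iff (lo hi x v : B7Prop1Explicit.Site d) : InBox (lo + v) (hi + v) (x + v) ↔ InBox lo hi x := by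
  refine forall_congr' fun i => ?_
  simp only [Pi.add_apply]
  constructor
  · rintro ⟨h1, h2⟩; constructor <;> omega
  · rintro ⟨h1, h2⟩; constructor <;> omega

/-- «The translated box lies in `S`» ↔ «the box lies in `S`» for a `T`-periodic `S` and a translation in `Tℤᵈ`. [cite: Balaban1985RegularSpaces, p.77 («Ω_j = T_η»)] -/
theorem forall_inBox_add_iff {T : ℕ} {S : Set (B7Prop1Explicit.Site d)} (hS : IsPeriodic T (· ∈ S)) (lo hi m : B7Prop1Explicit.Site d) :
    (∀ x, InBox (lo + (T : ℤ) • m) (hi + (T : ℤ) • m) x → x ∈ S) ↔ (∀ x, InBox lo hi x → x ∈ S) := by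
  constructor
  · intro h x hx
    have h1 : x + (T : ℤ) • m ∈ S := h _ ((inBox_add_iff lo hi x _).2 hx)
    exact (isPeriodic_mem_iff hS x m).1 h1
  · intro h x hx
    have hx' : InBox lo hi (x - (T : ℤ) • m) := by
      rw [← inBox_add_iff lo hi _ ((T : ℤ) • m), sub_add_cancel]; exact hx
    exact (isPeriodic_mem_sub_iff hS x m).1 (h _ hx')

/-- «The translated order-interval `[a, a + b]` lies in `S`» ↔ «`[a, a + b]` lies in `S`» for a `T′`-periodic `S` and a translation in `T′ℤᵈ` (the block `Γ_{b₋,x}` of (1.37)).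
[cite: Balaban1985RegularSpaces, (1.37) p.82] -/
theorem forall_block_add_iff {T' : ℕ} {S : Set (B7Prop1Explicit.Site d)} (hS : IsPeriodic T' (· ∈ S)) (a b m : B7Prop1Explicit.Site d) :
    (∀ x, a + (T' : ℤ) • m ≤ x → x ≤ a + (T' : ℤ) • m + b → x ∈ S) ↔ (∀ x, a ≤ x → x ≤ a + b → x ∈ S) := by
  constructor
  · intro h x h1 h2
    have h1' : a + (T' : ℤ) • m ≤ x + (T' : ℤ) • m := (add_le_add_iff_right _).2 h1
    have h2' : x + (T' : ℤ) • m ≤ a + (T' : ℤ) • m + b := by rw [add_right_comm]; exact (add_le_add_iff_right _).2 h2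
    exact (isPeriodic_mem_iff hS x m).1 (h _ h1' h2')
  · intro h x h1 h2
    have h1' : a ≤ x - (T' : ℤ) • m := by rw [le_sub_iff_add_le]; exact h1
    have h2' : x - (T' : ℤ) • m ≤ a + b := by rw [sub_le_iff_le_add, add_right_comm]; exact h2
    exact (isPeriodic_mem_sub_iff hS x m).1 (h _ h1' h2')

/-- ★ **The layer `Bˡ(Λ_l) = Ω_l ∖ Ω_{l+1}` (`Ω_k` at the top) of `T`-periodic domains is `T`-periodic.** [cite: Balaban1985RegularSpaces, (1.5)–(1.6) p.77, p.77 («Ω_j = T_η»)] -/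
theorem isPeriodic_layer {T : ℕ} {Ω : ℕ → Set (B7Prop1Explicit.Site d)} {k l : ℕ} (hΩl : IsPeriodic T (· ∈ Ω l))
    (hΩs : l < k → IsPeriodic T (· ∈ Ω (l + 1))) : IsPeriodic T (· ∈ layer Ω k l) := by
  refine isPeriodic_mem_of_iff fun x m => ?_
  show (x + (T : ℤ) • m ∈ Ω l ∧ (l < k → x + (T : ℤ) • m ∉ Ω (l + 1))) ↔ (x ∈ Ω l ∧ (l < k → x ∉ Ω (l + 1)))
  rw [isPeriodic_mem_iff hΩl]
  exact and_congr_right fun _ => forall_congr' fun hlk => not_congr (isPeriodic_mem_iff (hΩs hlk) x m)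

/-- ★★ **Print's level set `Λ_l` in level-`l` labels translates by `Q` when the domains translate by `T = Lˡ·Q`**: `y + Q•m ∈ Lam L Ω k l ↔ y ∈ Lam L Ω k l`.
[cite: Balaban1985RegularSpaces, (1.5) p.77, p.77 («Ω_j = T_η»); Balaban1985Variational, (3) p.278] -/
theorem lamK_add_zsmul_iff {L T Q : ℕ} {Ω : ℕ → Set (B7Prop1Explicit.Site d)} {k l : ℕ} (hT : T = L ^ l * Q) (hΩl : IsPeriodic T (· ∈ Ω l))
    (hΩs : l < k → IsPeriodic T (· ∈ Ω (l + 1))) (y m : B7Prop1Explicit.Site d) :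
    y + (Q : ℤ) • m ∈ B11Eq7Convention.Lam L Ω k l ↔ y ∈ B11Eq7Convention.Lam L Ω k l := by
  show loK L l (y + (Q : ℤ) • m) ∈ layer Ω k l ↔ loK L l y ∈ layer Ω k l
  rw [loK_add_zsmul]
  have hc : ((L : ℤ) ^ l) * (Q : ℤ) = ((T : ℕ) : ℤ) := by rw [hT]; push_cast; ring
  rw [hc]
  exact isPeriodic_mem_iff (isPeriodic_layer hΩl hΩs) _ m

/-- ★★ **`Λ_l` IS `Q`-PERIODIC IN LEVEL-`l` LABELS when `Ω_l` (and `Ω_{l+1}` if `l < k`) are `T`-periodic, `T = Lˡ·Q`** (`B7AvgPeriodicity`'s convention: fine period `LˡQ` ⇒ period `Q`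
on the `l`-th lattice). [cite: Balaban1985RegularSpaces, (1.5) p.77, p.77 («Ω_j = T_η»); Balaban1985Variational, (3) p.278] -/
theorem isPeriodic_lamK {L T Q : ℕ} {Ω : ℕ → Set (B7Prop1Explicit.Site d)} {k l : ℕ} (hT : T = L ^ l * Q) (hΩl : IsPeriodic T (· ∈ Ω l))
    (hΩs : l < k → IsPeriodic T (· ∈ Ω (l + 1))) : IsPeriodic Q (· ∈ B11Eq7Convention.Lam L Ω k l) :=
  isPeriodic_mem_of_iff fun y m => lamK_add_zsmul_iff hT hΩl hΩs y m

/-- ★★ **The tower-generated bond class translates**: for `T = Lˡ·Q`, `Ω_l` `T`-periodic, `Λ l` `Q`-periodic and `Λ (l−1)` `L·Q`-periodic (the block `Γ_{b₋,x}` of a crossing bond lives one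
level down), `(z + Q•m, κ) ∈ towerBonds L Ω Λ l ↔ (z, κ) ∈ towerBonds L Ω Λ l` — box clause, inner clause (1.31) and both crossing clauses (1.37) separately.
[cite: Balaban1985RegularSpaces, (1.31) p.82, (1.37) p.82, p.86 («𝔅_k»), p.77 («Ω_j = T_η»)] -/
theorem towerBonds_add_zsmul_iff {L T Q : ℕ} {Ω Λ : ℕ → Set (B7Prop1Explicit.Site d)} {l : ℕ} (hT : T = L ^ l * Q) (hΩl : IsPeriodic T (· ∈ Ω l))
    (hΛ : IsPeriodic Q (· ∈ Λ l)) (hΛ' : ∀ l', l = l' + 1 → IsPeriodic (L * Q) (· ∈ Λ l')) (z m : B7Prop1Explicit.Site d) (κ : Fin d) :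
    (z + (Q : ℤ) • m, κ) ∈ towerBonds L Ω Λ l ↔ (z, κ) ∈ towerBonds L Ω Λ l := by
  have hc : ((L : ℤ) ^ l) * (Q : ℤ) = ((T : ℕ) : ℤ) := by rw [hT]; push_cast; ring
  have hLQ : (L : ℤ) * (Q : ℤ) = (((L * Q : ℕ)) : ℤ) := by push_cast; ring
  have hze : z + (Q : ℤ) • m + e κ = (z + e κ) + (Q : ℤ) • m := add_right_comm _ _ _
  rw [mem_towerBonds_iff, mem_towerBonds_iff]
  refine and_congr ?_ (or_congr ?_ (or_congr ?_ ?_))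
  · rw [loK_add_zsmul, bondHiK_add_zsmul, hc]
    exact forall_inBox_add_iff hΩl _ _ m
  · rw [hze]
    exact and_congr (isPeriodic_mem_iff hΛ z m) (isPeriodic_mem_iff hΛ _ m)
  · refine exists_congr fun l' => and_congr_right fun hl' => and_congr ?_ ?_
    · rw [smul_add_zsmul, hLQ]
      exact forall_block_add_iff (hΛ' l' hl') _ _ m
    · rw [hze]
      exact isPeriodic_mem_iff hΛ _ m
  · refine exists_congr fun l' => and_congr_right fun hl' => and_congr (isPeriodic_mem_iff hΛ z m) ?_
    rw [hze, smul_add_zsmul, hLQ]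
    exact forall_block_add_iff (hΛ' l' hl') _ _ m

/-- ★★ **Every `κ`-section of the tower-generated bond class is `Q`-periodic** under the hypotheses of `towerBonds_add_zsmul_iff`.
[cite: Balaban1985RegularSpaces, (1.31) p.82, (1.37) p.82, p.86 («𝔅_k»), p.77 («Ω_j = T_η»)] -/
theorem isPeriodic_towerBonds {L T Q : ℕ} {Ω Λ : ℕ → Set (B7Prop1Explicit.Site d)} {l : ℕ} (hT : T = L ^ l * Q) (hΩl : IsPeriodic T (· ∈ Ω l))
    (hΛ : IsPeriodic Q (· ∈ Λ l)) (hΛ' : ∀ l', l = l' + 1 → IsPeriodic (L * Q) (· ∈ Λ l')) (κ : Fin d) :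
    IsPeriodic Q (fun z => (z, κ) ∈ towerBonds L Ω Λ l) :=
  fun z m => propext (towerBonds_add_zsmul_iff hT hΩl hΛ hΛ' z m κ)

/-- **The tower-generated class OF PRINT'S LEVEL SETS `B11Eq7Convention.Lam L Ω m` is `Q`-periodic from the Ω-periods alone** (`T = Lˡ·Q`; levels `l − 1`, `l`, and `l + 1` if `l < m`).
[cite: Balaban1985RegularSpaces, (1.5) p.77, (1.31) p.82, (1.37) p.82, p.86 («𝔅_k»)] -/
theorem isPeriodic_towerBonds_lam {L T Q : ℕ} {Ω : ℕ → Set (B7Prop1Explicit.Site d)} {m l : ℕ} (hT : T = L ^ l * Q) (hlm : l ≤ m)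
    (hΩp : ∀ l', l' ≤ l - 1 → IsPeriodic T (· ∈ Ω l')) (hΩl : IsPeriodic T (· ∈ Ω l)) (hΩs : l < m → IsPeriodic T (· ∈ Ω (l + 1))) (κ : Fin d) :
    IsPeriodic Q (fun z => (z, κ) ∈ towerBonds L Ω (B11Eq7Convention.Lam L Ω m) l) := by
  refine isPeriodic_towerBonds hT hΩl (isPeriodic_lamK hT hΩl hΩs) (fun l' hl' => ?_) κ
  subst hl'
  have hT' : T = L ^ l' * (L * Q) := by rw [hT]; ring
  exact isPeriodic_lamK hT' (hΩp l' (by omega)) fun _ => hΩl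

end Generic

/-! ## §2 On the (1.5)-obeying index of record `IdxB8SubD θ`: the towers inherit the periodicity of the domains (rigidity) -/

section SubD

variable {θ : Stage3Params}

/-- ★★ **AT A (1.5)-MEMBER, `T`-PERIODIC DOMAINS (`T = θ.Lˡ·Q`, levels `≤ k`) MAKE THE CONSTRAINT FAMILY `Λs m l` `Q`-PERIODIC** (`l ≤ m ≤ k`): by rigidity `Λs m l = Lam θ.L Ω m l`
(`B8IdxB8SubDRigidity.IdxB8SubD.Λs_eq_lam`) and §1. [cite: Balaban1985RegularSpaces, (1.5)–(1.6) p.77, (1.68) p.88, p.77 («Ω_j = T_η»)] -/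
theorem IdxB8SubD.isPeriodic_Λs (j : IdxB8SubD θ) {T : ℕ} (hΩ : ∀ l, l ≤ j.1.1.1.1.k → IsPeriodic T (· ∈ j.1.1.1.1.Ω l))
    {m : ℕ} (hm : m ≤ j.1.1.1.1.k) {l : ℕ} (hl : l ≤ m) {Q : ℕ} (hT : T = θ.L ^ l * Q) :
    IsPeriodic Q (· ∈ j.1.1.1.1.Λs m l) := by
  rw [B8IdxB8SubDRigidity.IdxB8SubD.Λs_eq_lam j hm hl]
  exact isPeriodic_lamK hT (hΩ l (by omega)) fun hlm => hΩ (l + 1) (by omega)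

/-- ★★ **… AND EVERY `κ`-SECTION OF THE CONSTRAINT-BOND CLASS `Λb m l` `Q`-PERIODIC** (`l ≤ m ≤ k`): by №12 over the canonical families
(`B8IdxB8SubDRigidity.IdxB8SubD.Λb_eq_towerBonds_lam`) and §1. [cite: Balaban1985RegularSpaces, (1.31) p.82, (1.37) p.82, p.86 («𝔅_k»), (1.5) p.77, p.77 («Ω_j = T_η»)] -/
theorem IdxB8SubD.isPeriodic_Λb (j : IdxB8SubD θ) {T : ℕ} (hΩ : ∀ l, l ≤ j.1.1.1.1.k → IsPeriodic T (· ∈ j.1.1.1.1.Ω l))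
    {m : ℕ} (hm : m ≤ j.1.1.1.1.k) {l : ℕ} (hl : l ≤ m) {Q : ℕ} (hT : T = θ.L ^ l * Q) (κ : Fin θ.D) :
    IsPeriodic Q (fun z => (z, κ) ∈ j.1.1.1.1.Λb m l) := by
  rw [B8IdxB8SubDRigidity.IdxB8SubD.Λb_eq_towerBonds_lam j hm hl]
  exact isPeriodic_towerBonds_lam hT hl (fun l' hl' => hΩ l' (by omega)) (hΩ l (by omega)) (fun hlm => hΩ (l + 1) (by omega)) κ

/-- The `Iff` reading of `IdxB8SubD.isPeriodic_Λs`: `z + Q•m ∈ Λs m l ↔ z ∈ Λs m l`. [cite: Balaban1985RegularSpaces, (1.5)–(1.6) p.77, p.77 («Ω_j = T_η»)] -/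
theorem IdxB8SubD.mem_Λs_add_zsmul_iff (j : IdxB8SubD θ) {T : ℕ} (hΩ : ∀ l, l ≤ j.1.1.1.1.k → IsPeriodic T (· ∈ j.1.1.1.1.Ω l))
    {m : ℕ} (hm : m ≤ j.1.1.1.1.k) {l : ℕ} (hl : l ≤ m) {Q : ℕ} (hT : T = θ.L ^ l * Q) (z v : B7Prop1Explicit.Site θ.D) :
    z + (Q : ℤ) • v ∈ j.1.1.1.1.Λs m l ↔ z ∈ j.1.1.1.1.Λs m l :=
  Iff.of_eq (IdxB8SubD.isPeriodic_Λs j hΩ hm hl hT z v)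

/-- The `Iff` reading of `IdxB8SubD.isPeriodic_Λb`: `(z + Q•m, κ) ∈ Λb m l ↔ (z, κ) ∈ Λb m l`. [cite: Balaban1985RegularSpaces, (1.31) p.82, p.86 («𝔅_k»), p.77 («Ω_j = T_η»)] -/
theorem IdxB8SubD.mem_Λb_add_zsmul_iff (j : IdxB8SubD θ) {T : ℕ} (hΩ : ∀ l, l ≤ j.1.1.1.1.k → IsPeriodic T (· ∈ j.1.1.1.1.Ω l))
    {m : ℕ} (hm : m ≤ j.1.1.1.1.k) {l : ℕ} (hl : l ≤ m) {Q : ℕ} (hT : T = θ.L ^ l * Q) (z v : B7Prop1Explicit.Site θ.D) (κ : Fin θ.D) :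
    (z + (Q : ℤ) • v, κ) ∈ j.1.1.1.1.Λb m l ↔ (z, κ) ∈ j.1.1.1.1.Λb m l :=
  Iff.of_eq (IdxB8SubD.isPeriodic_Λb j hΩ hm hl hT κ z v)

/-- The TOP-truncation reading (`m = k`) of `IdxB8SubD.isPeriodic_Λs`: the member's own constraint tower `Λs k l` is `Q`-periodic. [cite: Balaban1985RegularSpaces, (1.5)–(1.6) p.77] -/
theorem IdxB8SubD.isPeriodic_Λs_top (j : IdxB8SubD θ) {T : ℕ} (hΩ : ∀ l, l ≤ j.1.1.1.1.k → IsPeriodic T (· ∈ j.1.1.1.1.Ω l))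
    {l : ℕ} (hl : l ≤ j.1.1.1.1.k) {Q : ℕ} (hT : T = θ.L ^ l * Q) : IsPeriodic Q (· ∈ j.1.1.1.1.Λs j.1.1.1.1.k l) :=
  IdxB8SubD.isPeriodic_Λs j hΩ le_rfl hl hT

/-- The TOP-truncation reading (`m = k`) of `IdxB8SubD.isPeriodic_Λb`. [cite: Balaban1985RegularSpaces, (1.31) p.82, p.86 («𝔅_k»)] -/
theorem IdxB8SubD.isPeriodic_Λb_top (j : IdxB8SubD θ) {T : ℕ} (hΩ : ∀ l, l ≤ j.1.1.1.1.k → IsPeriodic T (· ∈ j.1.1.1.1.Ω l))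
    {l : ℕ} (hl : l ≤ j.1.1.1.1.k) {Q : ℕ} (hT : T = θ.L ^ l * Q) (κ : Fin θ.D) :
    IsPeriodic Q (fun z => (z, κ) ∈ j.1.1.1.1.Λb j.1.1.1.1.k l) :=
  IdxB8SubD.isPeriodic_Λb j hΩ le_rfl hl hT κ

/-- `Lᵏ ∣ T`, `l ≤ k` ⇒ `T = Lˡ · (T ∕ Lˡ)` (private arithmetic plumbing for the divisibility forms). [folklore] -/
private theorem eq_pow_mul_div_of_dvd {L T k l : ℕ} (hdvd : L ^ k ∣ T) (hl : l ≤ k) : T = L ^ l * (T / L ^ l) :=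
  (Nat.mul_div_cancel' ((pow_dvd_pow L hl).trans hdvd)).symm

/-- **Divisibility form**: domains `T`-periodic up to level `k` with `θ.Lᵏ ∣ T` ⇒ `Λs m l` is `(T ∕ θ.Lˡ)`-periodic (`l ≤ m ≤ k`). [cite: Balaban1985RegularSpaces, (1.5)–(1.6) p.77, p.77 («Ω_j = T_η»)] -/
theorem IdxB8SubD.isPeriodic_Λs_of_dvd (j : IdxB8SubD θ) {T : ℕ} (hΩ : ∀ l, l ≤ j.1.1.1.1.k → IsPeriodic T (· ∈ j.1.1.1.1.Ω l))
    (hdvd : θ.L ^ j.1.1.1.1.k ∣ T) {m : ℕ} (hm : m ≤ j.1.1.1.1.k) {l : ℕ} (hl : l ≤ m) :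
    IsPeriodic (T / θ.L ^ l) (· ∈ j.1.1.1.1.Λs m l) :=
  IdxB8SubD.isPeriodic_Λs j hΩ hm hl (eq_pow_mul_div_of_dvd hdvd (hl.trans hm))

/-- **Divisibility form** for the bond classes: `Λb m l` has `(T ∕ θ.Lˡ)`-periodic `κ`-sections (`l ≤ m ≤ k`). [cite: Balaban1985RegularSpaces, (1.31) p.82, p.86 («𝔅_k»), p.77 («Ω_j = T_η»)] -/
theorem IdxB8SubD.isPeriodic_Λb_of_dvd (j : IdxB8SubD θ) {T : ℕ} (hΩ : ∀ l, l ≤ j.1.1.1.1.k → IsPeriodic T (· ∈ j.1.1.1.1.Ω l))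
    (hdvd : θ.L ^ j.1.1.1.1.k ∣ T) {m : ℕ} (hm : m ≤ j.1.1.1.1.k) {l : ℕ} (hl : l ≤ m) (κ : Fin θ.D) :
    IsPeriodic (T / θ.L ^ l) (fun z => (z, κ) ∈ j.1.1.1.1.Λb m l) :=
  IdxB8SubD.isPeriodic_Λb j hΩ hm hl (eq_pow_mul_div_of_dvd hdvd (hl.trans hm)) κ

end SubD

/-! ## §3 Inhabitation support: print's all-torus tower «Ω_j = T_η for all j» is a member of `IdxB8SubD θ`, periodic for every period -/

section Inhabited

/-- `ℤᵈ` is `T`-periodic for every `T`. [cite: Balaban1985RegularSpaces, p.77 («Ω_j = T_η»)] -/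
theorem isPeriodic_mem_univ (T : ℕ) : IsPeriodic T (· ∈ (Set.univ : Set (B7Prop1Explicit.Site d))) :=
  isPeriodic_mem_of_iff fun _ _ => by simp only [Set.mem_univ]

/-- The constant tower `Ω_j = ℤᵈ` obeys (1.3)–(1.4) (`B8ConstraintBonds.DomainSeq`) trivially (private plumbing; the P2 index file `Node00/CarriersB8SubDPer` carries the public
`domainSeq_univTower`). [cite: Balaban1985RegularSpaces, (1.3)–(1.4) p.77, p.77 («Ω_j = T_η»)] -/
private theorem domainSeq_univ (L : ℕ) : DomainSeq L (fun _ => (Set.univ : Set (B7Prop1Explicit.Site d))) where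
  anti := fun _ => le_rfl
  sat := fun _ _ _ _ _ => Set.mem_univ _
  sep := fun _ _ _ _ _ => Set.mem_univ _

variable (θ : Stage3Params)

/-- ★ **PRINT'S ALL-TORUS TOWER IS A (1.5)-MEMBER AT EVERY DEPTH**: for `k ≥ 1` there is `j : IdxB8SubD θ` with `j.k = k`, `j.η = θ.L⁻ᵏ` and `j.Ω = fun _ ↦ ℤᵈ` («Ω_j = T_η for
j = 0, …, k», the member class of `B8Thm2TorusAt` ∕ `B8Thm4TorusAt`), its families pinned to print's (`B8IdxB8SubDRigidity.exists_idxB8SubD_of_domainSeq`).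
[cite: Balaban1985RegularSpaces, p.77 («Ω_j = T_η for j = 0,1,…,l, l ≤ k»), (1.3)–(1.6) p.77] -/
theorem exists_idxB8SubD_univTower {k : ℕ} (hk : 1 ≤ k) :
    ∃ j : IdxB8SubD θ, j.1.1.1.1.k = k ∧ j.1.1.1.1.η = ((θ.L : ℝ) ^ k)⁻¹ ∧ j.1.1.1.1.Ω = fun _ => Set.univ := by
  have hL : (0 : ℝ) < (θ.L : ℝ) ^ k := by
    have h2 : (2 : ℝ) ≤ θ.L := by exact_mod_cast θ.two_le_L
    positivity
  obtain ⟨j, hη, hjk, hΩ, -⟩ := exists_idxB8SubD_of_domainSeq θ (Ω := fun _ => (Set.univ : Set (B7Prop1Explicit.Site θ.D)))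
    (inv_pos.2 hL) hk (by rw [mul_inv_cancel₀ hL.ne']) rfl (domainSeq_univ θ.L)
  exact ⟨j, hjk, hη, hΩ⟩

/-- ★ **… AND THAT MEMBER IS `T`-PERIODIC FOR EVERY `T`, DOMAINS AND TOWERS**: all `Ω_l` are `T`-periodic, and for `l ≤ m ≤ k`, `T = θ.Lˡ·Q`, the families `Λs m l` and the
`κ`-sections of `Λb m l` are `Q`-periodic (§2) — the inhabitant a `T`-periodic cut of `IdxB8SubD θ` needs, at every depth and every period.
[cite: Balaban1985RegularSpaces, p.77 («Ω_j = T_η»), (1.5)–(1.6) p.77, p.86 («𝔅_k»)] -/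
theorem exists_idxB8SubD_isPeriodic {k : ℕ} (hk : 1 ≤ k) :
    ∃ j : IdxB8SubD θ, j.1.1.1.1.k = k ∧ (j.1.1.1.1.Ω = fun _ => Set.univ) ∧ (∀ T l, IsPeriodic T (· ∈ j.1.1.1.1.Ω l)) ∧
      (∀ (T Q m l : ℕ), m ≤ k → l ≤ m → T = θ.L ^ l * Q → IsPeriodic Q (· ∈ j.1.1.1.1.Λs m l)) ∧
      (∀ (T Q m l : ℕ), m ≤ k → l ≤ m → T = θ.L ^ l * Q → ∀ κ, IsPeriodic Q (fun z => (z, κ) ∈ j.1.1.1.1.Λb m l)) := by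
  obtain ⟨j, hjk, -, hΩ⟩ := exists_idxB8SubD_univTower θ hk
  have hper : ∀ T l, IsPeriodic T (· ∈ j.1.1.1.1.Ω l) := fun T l => by rw [hΩ]; exact isPeriodic_mem_univ T
  refine ⟨j, hjk, hΩ, hper, fun T Q m l hm hl hT => ?_, fun T Q m l hm hl hT κ => ?_⟩
  · exact IdxB8SubD.isPeriodic_Λs j (fun l _ => hper T l) (hjk ▸ hm) hl hT
  · exact IdxB8SubD.isPeriodic_Λb j (fun l _ => hper T l) (hjk ▸ hm) hl hT κ

end Inhabited

end Literature.MathematicalPhysics.QuantumFieldTheory.Balaban1983to89.B8IdxB8SubDPeriodicTowers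

end
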